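import Mathlib.NumberTheory.LegendreSymbol.JacobiSymbol
import Literature.NumberTheory.EllipticCurves.TwoDescentLocalTwo
import Literature.NumberTheory.EllipticCurves.Curve24A1Descent
import HarnessLib

/-!
# Local conditions of the complete `2`-descent over `ℚ`, II: primes of type `I₀*`, signs, and
# the square-free kernel

Continuation of `TwoDescentLocalOdd.lean` / `TwoDescentLocalTwo.lean` (the `p`-unit part
`unitPart p a` of a rational, its residue `res p a ∈ 𝔽_p` and quadratic-residue bit
`qrBit p a ∈ ℤ/2`, and the local conditions at an odd prime of MULTIPLICATIVE type). For the
complete `2`-descent `P = (x, y) ↦ (x - e₁, x - e₂) ∈ ℚ^×/ℚ^{×2} × ℚ^×/ℚ^{×2}` of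
`E : y² = (x - e₁)(x - e₂)(x - e₃)` (Silverman, *The Arithmetic of Elliptic Curves*, 2nd ed.,
Prop. X.1.4; tree `WeierstrassCurve.Affine.Point.twoDescentMap`) this file proves, for RATIONAL
points and in terms of `parityBit`, `signBit` (tree `KramerTwoDescentSquares.lean`) and `qrBit`:

* `local_condition_I0` — the local condition at an odd prime `p` at which ALL three differences
  `eᵢ - eⱼ` have valuation exactly `1` (Kodaira type `I₀*`; e.g. an odd prime `p ∥ D` for the
  quadratic twist by `D` of a curve with good reduction at `p`, such as the congruent number
  curves `y² = x³ - n²x` at `p ∣ n`): the pair of local classes of `(x - e₁, x - e₂)` is that of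
  `O`, `T₁`, `T₂` or `T₃`, an explicit four-way disjunction on the parity and residue bits, i.e.
  two linear conditions;
* `signBit_sub_of_lt_of_lt` — the condition at the real place (`x - e_min > 0`, the other two
  factors of equal sign);
* `qrBit_eq_signBit_add_sum` / `qrBit_eq_signBit_add_listSum` — the square-free kernel:
  `qrBit p r = signBit r · qrBit p (-1) + Σ_q (v_q(r) mod 2) · qrBit p q` over the primes `q` of
  possibly odd valuation, which turns residue conditions into LINEAR conditions on the sign and
  parity coordinates of the descent (how Legendre symbols enter a `2`-Selmer computation);
* small API: `qrBit` of `p`-power multiples, of integers (Legendre/Jacobi symbol, so that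
  `norm_num` evaluates it), ultrametric invariance `qrBit_add_eq_left`.

Everything is proved; no named facts. Consumer: the rank computations for congruent number
curves behind `Literature/Barriers/BirchSwinnertonDyer/RankNotSumOfLocalInvariants*.lean`.

## References

* J. H. Silverman, *The Arithmetic of Elliptic Curves*, 2nd ed., GTM 106 (2009), X.1
  Prop. 1.4 (Complete 2-Descent) and Example 1.5, pp. 270–271 of the held copy; X.4
  Prop. 4.9 and Example 4.10, pp. 289–290. [SilvermanAEC2009]
* J.-P. Serre, *A Course in Arithmetic* (1973), Ch. II §3.3 (square classes of `ℚ_p`). [Serre1973]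
-/

noncomputable section

open scoped Classical

namespace Literature.NumberTheory.EllipticCurves.TwoDescentLocal

open Literature.NumberTheory.EllipticCurves.KramerTwoDescent

/-! ### More on unit parts and `qrBit` -/

section QrBit

variable {p : ℕ} [hp : Fact p.Prime]

/-- The valuation at other primes is unchanged by removing the `p`-part. [folklore] -/
theorem padicValRat_unitPart_of_ne {q : ℕ} [hq : Fact q.Prime] (hqp : q ≠ p) (r : ℚ) :
    padicValRat q (unitPart p r) = padicValRat q r := by
  by_cases hr : r = 0
  · simp [hr, unitPart]
  have hp0 : (p : ℚ) ≠ 0 := Nat.cast_ne_zero.mpr hp.out.ne_zero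
  rw [unitPart, padicValRat.div hr (zpow_ne_zero _ hp0), padicValRat.zpow, padicValRat.of_nat,
    padicValNat_primes hqp]
  simp

/-- The unit part of a positive rational is positive. [folklore] -/
theorem unitPart_pos {r : ℚ} (hr : 0 < r) : 0 < unitPart p r :=
  div_pos hr (zpow_pos (Nat.cast_pos.mpr hp.out.pos) _)

/-- The unit part has the sign of the number. [folklore] -/
theorem signBit_unitPart (r : ℚ) : signBit (unitPart p r) = signBit r := by
  unfold signBit unitPart
  have hpos : (0 : ℚ) < (p : ℚ) ^ padicValRat p r := zpow_pos (Nat.cast_pos.mpr hp.out.pos) _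
  by_cases h : r < 0
  · rw [if_pos h, if_pos (div_neg_of_neg_of_pos h hpos)]
  · rw [if_neg h, if_neg (not_lt.mpr (div_nonneg (not_lt.mp h) hpos.le))]

/-- Multiplying by a power of `p` does not change `qrBit`. [folklore] -/
theorem qrBit_zpow_mul (k : ℤ) (r : ℚ) : qrBit p ((p : ℚ) ^ k * r) = qrBit p r := by
  by_cases hr : r = 0
  · rw [hr, mul_zero]
  exact qrBit_congr p (by rw [res, res, unitPart_zpow_mul p k hr])

/-- `qrBit p (p r) = qrBit p r`. [folklore] -/
theorem qrBit_natCast_mul (r : ℚ) : qrBit p ((p : ℚ) * r) = qrBit p r := by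
  simpa using qrBit_zpow_mul (p := p) 1 r

/-- `qrBit` only depends on the unit part. [folklore] -/
theorem qrBit_unitPart (r : ℚ) : qrBit p (unitPart p r) = qrBit p r := by
  by_cases hr : r = 0
  · simp [hr, unitPart]
  exact qrBit_congr p (by rw [res, res, unitPart_of_eq_zero p (padicValRat_unitPart p hr)])

/-- **On integers prime to `p`, `qrBit` is the Legendre symbol.** [folklore] -/
theorem qrBit_intCast {m : ℤ} (hm : ¬ (p : ℤ) ∣ m) :
    qrBit p (m : ℚ) = if legendreSym p m = -1 then 1 else 0 := by
  rw [qrBit, res_of_eq_zero p (padicValRat_intCast_eq_zero hm), Rat.cast_intCast, legendreSym]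

/-- Evaluation through the Jacobi symbol (which `norm_num` computes), residue case. [folklore] -/
theorem qrBit_intCast_of_jacobiSym_eq_one {m : ℤ} (h : jacobiSym m p = 1) :
    qrBit p (m : ℚ) = 0 := by
  have hm : ¬ (p : ℤ) ∣ m := fun hd => by
    rw [← jacobiSym.legendreSym.to_jacobiSym, legendreSym.eq_zero_iff p m |>.mpr
      (by rwa [ZMod.intCast_zmod_eq_zero_iff_dvd])] at h
    exact zero_ne_one h
  rw [qrBit_intCast hm, jacobiSym.legendreSym.to_jacobiSym, h, if_neg (by decide)]

/-- Evaluation through the Jacobi symbol, non-residue case. [folklore] -/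
theorem qrBit_intCast_of_jacobiSym_eq_neg_one {m : ℤ} (h : jacobiSym m p = -1) :
    qrBit p (m : ℚ) = 1 := by
  have hm : ¬ (p : ℤ) ∣ m := fun hd => by
    rw [← jacobiSym.legendreSym.to_jacobiSym, legendreSym.eq_zero_iff p m |>.mpr
      (by rwa [ZMod.intCast_zmod_eq_zero_iff_dvd])] at h
    exact absurd h (by decide)
  rw [qrBit_intCast hm, jacobiSym.legendreSym.to_jacobiSym, h, if_pos rfl]

/-- Evaluation: `qrBit p (p^k m) = 0` when `(m/p) = 1`. [folklore] -/
theorem qrBit_eq_zero_of_eq {r : ℚ} (k : ℕ) (m : ℤ) (h : r = (p : ℚ) ^ k * m)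
    (hj : jacobiSym m p = 1) : qrBit p r = 0 := by
  rw [h, ← zpow_natCast, qrBit_zpow_mul, qrBit_intCast_of_jacobiSym_eq_one hj]

/-- Evaluation: `qrBit p (p^k m) = 1` when `(m/p) = -1`. [folklore] -/
theorem qrBit_eq_one_of_eq {r : ℚ} (k : ℕ) (m : ℤ) (h : r = (p : ℚ) ^ k * m)
    (hj : jacobiSym m p = -1) : qrBit p r = 1 := by
  rw [h, ← zpow_natCast, qrBit_zpow_mul, qrBit_intCast_of_jacobiSym_eq_neg_one hj]

/-- `qrBit p 1 = 0`. [folklore] -/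
theorem qrBit_one : qrBit p 1 = 0 := by
  have h := qrBit_mul_self p 1
  rwa [mul_one] at h

/-- `qrBit p (-r) = qrBit p (-1) + qrBit p r`. [folklore] -/
theorem qrBit_neg {r : ℚ} (hr : r ≠ 0) : qrBit p (-r) = qrBit p (-1) + qrBit p r := by
  rw [← qrBit_mul p (by norm_num) hr, neg_one_mul]

/-- **Ultrametric invariance of `qrBit`**: if `v_p(a) < v_p(b)` (or `b = 0`) then
`qrBit p (a + b) = qrBit p a` (`res_add_of_lt`). [folklore] -/
theorem qrBit_add_eq_left {a b : ℚ} (ha : a ≠ 0)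
    (h : b = 0 ∨ padicValRat p a < padicValRat p b) : qrBit p (a + b) = qrBit p a :=
  qrBit_congr p (res_add_of_lt p ha h)

end QrBit

/-! ### Rational points of `y² = (x - e₁)(x - e₂)(x - e₃)`: signs and primes of type `I₀*` -/

section Curve

variable {p : ℕ} [hp : Fact p.Prime]

omit hp in
/-- On `y² = (x - e₁)(x - e₂)(x - e₃)` with `y ≠ 0`, no factor vanishes (rational roots).
[folklore] -/
theorem sub_ne_zero_of_sq_eq {e₁ e₂ e₃ x y : ℚ} (h : y ^ 2 = (x - e₁) * (x - e₂) * (x - e₃))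
    (hy : y ≠ 0) : x - e₁ ≠ 0 ∧ x - e₂ ≠ 0 ∧ x - e₃ ≠ 0 := by
  have hy2 : y ^ 2 ≠ 0 := pow_ne_zero 2 hy
  rw [h] at hy2
  exact ⟨fun h0 => hy2 (by rw [h0, zero_mul, zero_mul]), fun h0 => hy2 (by rw [h0, mul_zero, zero_mul]),
    fun h0 => hy2 (by rw [h0, mul_zero])⟩

omit hp in
/-- The parity bit of an odd valuation. [folklore] -/
theorem parityBit_eq_one_of_odd {a : ℚ} (ha : Odd (padicValRat p a)) : parityBit p a = 1 := by
  obtain ⟨k, hk⟩ := ha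
  rw [parityBit, hk, Int.cast_add, Int.cast_mul, Int.cast_one]
  rw [show ((2 : ℤ) : ZMod 2) = 0 from rfl, zero_mul, zero_add]

omit hp in
/-- The parity bit of an even valuation. [folklore] -/
theorem parityBit_eq_zero_of_even {a : ℚ} (ha : Even (padicValRat p a)) : parityBit p a = 0 :=
  parityBit_eq_zero_iff.mpr ha

omit hp in
/-- **Signs** (the local condition at the real place): on `y² = (x - e₁)(x - e₂)(x - e₃)`,
`y ≠ 0`, with `e₁` the smallest root, `x - e₁ > 0` and `x - e₂`, `x - e₃` have the same sign
(the real points lie on `e₁ ≤ x ≤ min(e₂,e₃)` or `x ≥ max(e₂,e₃)`; Silverman AEC Example X.1.5,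
notes 1–2). [cite: SilvermanAEC2009, Example X.1.5] -/
theorem sub_pos_of_lt_of_lt {e₁ e₂ e₃ x y : ℚ} (h : y ^ 2 = (x - e₁) * (x - e₂) * (x - e₃))
    (hy : y ≠ 0) (h12 : e₁ < e₂) (h13 : e₁ < e₃) :
    0 < x - e₁ ∧ (x - e₂ < 0 ↔ x - e₃ < 0) := by
  obtain ⟨hd₁, hd₂, hd₃⟩ := sub_ne_zero_of_sq_eq h hy
  have hy2 : 0 < y ^ 2 := by positivity
  rw [h] at hy2
  have hpos : 0 < x - e₁ := by
    by_contra hle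
    rw [not_lt] at hle
    have h2 : x - e₂ < 0 := by linarith
    have h3 : x - e₃ < 0 := by linarith
    have : (x - e₁) * (x - e₂) * (x - e₃) ≤ 0 :=
      mul_nonpos_of_nonneg_of_nonpos (mul_nonneg_of_nonpos_of_nonpos hle h2.le) h3.le
    linarith
  refine ⟨hpos, ?_⟩
  have hprod : 0 < (x - e₂) * (x - e₃) := by
    have : 0 < (x - e₁) * ((x - e₂) * (x - e₃)) := by rw [← mul_assoc]; exact hy2
    exact pos_of_mul_pos_right this hpos.le
  constructor
  · intro h2
    by_contra h3
    rw [not_lt] at h3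
    have : (x - e₂) * (x - e₃) ≤ 0 := mul_nonpos_of_nonpos_of_nonneg h2.le h3
    linarith
  · intro h3
    by_contra h2
    rw [not_lt] at h2
    have : (x - e₂) * (x - e₃) ≤ 0 := mul_nonpos_of_nonneg_of_nonpos h2 h3.le
    linarith

omit hp in
/-- Signs, in terms of `signBit`. [cite: SilvermanAEC2009, Example X.1.5] -/
theorem signBit_sub_of_lt_of_lt {e₁ e₂ e₃ x y : ℚ} (h : y ^ 2 = (x - e₁) * (x - e₂) * (x - e₃))
    (hy : y ≠ 0) (h12 : e₁ < e₂) (h13 : e₁ < e₃) :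
    signBit (x - e₁) = 0 ∧ signBit (x - e₂) = signBit (x - e₃) := by
  obtain ⟨hpos, hiff⟩ := sub_pos_of_lt_of_lt h hy h12 h13
  refine ⟨by rw [signBit, if_neg (not_lt.mpr hpos.le)], ?_⟩
  unfold signBit
  by_cases h2 : x - e₂ < 0
  · rw [if_pos h2, if_pos (hiff.mp h2)]
  · rw [if_neg h2, if_neg (fun h3 => h2 (hiff.mpr h3))]

/-- From `y² = d₁ d₂ d₃` (rational factors): the residue bits of the three factors sum to zero.
[folklore] -/
theorem qrBit_factors_sum_eq_zero {d₁ d₂ d₃ y : ℚ} (h : y ^ 2 = d₁ * d₂ * d₃) (h₁ : d₁ ≠ 0)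
    (h₂ : d₂ ≠ 0) (h₃ : d₃ ≠ 0) : qrBit p d₁ + qrBit p d₂ + qrBit p d₃ = 0 := by
  rw [← qrBit_mul p h₁ h₂, ← qrBit_mul p (mul_ne_zero h₁ h₂) h₃, ← h, qrBit_sq]

omit hp in
/-- In `ℤ/2`, `a + b + c = 0` gives `a = b + c`. [folklore] -/
theorem zmod2_eq_add_of_add_add_eq_zero {a b c : ZMod 2} (h : a + b + c = 0) : a = b + c := by
  revert a b c; decide

/-- **The local condition at an odd prime of type `I₀*`** (a prime `p` at which all three
differences `eᵢ - eⱼ` have valuation exactly `1` — e.g. an odd prime `p ∥ D` for the quadratic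
twist by `D` of a curve with good reduction at `p`). For a rational point `(x, y)`, `y ≠ 0`, of
`y² = (x - e₁)(x - e₂)(x - e₃)`, the pair of local square classes of `(x - e₁, x - e₂)` at `p`
— recorded by the parity bits `v_p mod 2` and the residue bits of the unit parts — is that of
`O`, `T₁`, `T₂` or `T₃` under the `2`-descent map, i.e. one of `(1, 1)`,
`((e₁-e₂)(e₁-e₃), e₁-e₂)`, `(e₂-e₁, (e₂-e₁)(e₂-e₃))`, `(e₃-e₁, e₃-e₂)`: the image of
`E(ℚ_p)/2E(ℚ_p)` (of order `4` for `p` odd, Silverman AEC X.1, proof of Thm. 1.1 / Exercise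
10.?) is here the image of the `2`-torsion. Elementary proof by the ultrametric inequality:
either `v_p(x - e₁) ≤ 0` and all three factors have the same valuation and congruent unit parts,
or `x ≡ eᵢ (mod p)` and exactly one of `(x - eᵢ)/p` is a non-unit, of odd valuation.
[cite: SilvermanAEC2009, Prop. X.1.4] -/
theorem local_condition_I0 {e₁ e₂ e₃ x y : ℚ} (h : y ^ 2 = (x - e₁) * (x - e₂) * (x - e₃))
    (hy : y ≠ 0) (h12 : padicValRat p (e₁ - e₂) = 1) (h13 : padicValRat p (e₁ - e₃) = 1)
    (h23 : padicValRat p (e₂ - e₃) = 1) :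
    (parityBit p (x - e₁) = 0 ∧ qrBit p (x - e₁) = 0 ∧
        parityBit p (x - e₂) = 0 ∧ qrBit p (x - e₂) = 0) ∨
      (parityBit p (x - e₁) = 0 ∧ qrBit p (x - e₁) = qrBit p ((e₁ - e₂) * (e₁ - e₃)) ∧
        parityBit p (x - e₂) = 1 ∧ qrBit p (x - e₂) = qrBit p (e₁ - e₂)) ∨
      (parityBit p (x - e₁) = 1 ∧ qrBit p (x - e₁) = qrBit p (e₂ - e₁) ∧
        parityBit p (x - e₂) = 0 ∧ qrBit p (x - e₂) = qrBit p ((e₂ - e₁) * (e₂ - e₃))) ∨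
      (parityBit p (x - e₁) = 1 ∧ qrBit p (x - e₁) = qrBit p (e₃ - e₁) ∧
        parityBit p (x - e₂) = 1 ∧ qrBit p (x - e₂) = qrBit p (e₃ - e₂)) := by
  obtain ⟨hd₁, hd₂, hd₃⟩ := sub_ne_zero_of_sq_eq h hy
  have hp0 : (p : ℚ) ≠ 0 := Nat.cast_ne_zero.mpr hp.out.ne_zero
  have hvp : padicValRat p (p : ℚ) = 1 := padicValRat.self hp.out.one_lt
  have he12 : e₁ - e₂ ≠ 0 := by rintro h0; rw [h0] at h12; simp at h12
  have he13 : e₁ - e₃ ≠ 0 := by rintro h0; rw [h0] at h13; simp at h13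
  have he23 : e₂ - e₃ ≠ 0 := by rintro h0; rw [h0] at h23; simp at h23
  have hsum := even_sum_padicValRat_of_sq (p := p) h hd₁ hd₂ hd₃
  have hl := qrBit_factors_sum_eq_zero (p := p) h hd₁ hd₂ hd₃
  have hx₂ : x - e₂ = (x - e₁) + (e₁ - e₂) := by ring
  have hx₃ : x - e₃ = (x - e₁) + (e₁ - e₃) := by ring
  set v := padicValRat p (x - e₁) with hv
  by_cases hv1 : v < 1
  · -- all three factors have valuation `v` (even) and the same residue bit (zero)
    left
    have h2v : padicValRat p (x - e₂) = v := by
      rw [hx₂]; exact (padicValRat_add_eq_left hd₁ (Or.inr (by rw [h12]; omega))).2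
    have h3v : padicValRat p (x - e₃) = v := by
      rw [hx₃]; exact (padicValRat_add_eq_left hd₁ (Or.inr (by rw [h13]; omega))).2
    have h2l : qrBit p (x - e₂) = qrBit p (x - e₁) := by
      rw [hx₂]; exact qrBit_add_eq_left hd₁ (Or.inr (by rw [h12]; omega))
    have h3l : qrBit p (x - e₃) = qrBit p (x - e₁) := by
      rw [hx₃]; exact qrBit_add_eq_left hd₁ (Or.inr (by rw [h13]; omega))
    rw [h2l, h3l] at hl
    have hl1 : qrBit p (x - e₁) = 0 := by
      revert hl; generalize qrBit p (x - e₁) = a; revert a; decide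
    rw [h2v, h3v] at hsum
    have heven : Even v := by obtain ⟨k, hk⟩ := hsum; exact ⟨k - v, by omega⟩
    exact ⟨parityBit_eq_zero_of_even heven, hl1, parityBit_eq_zero_of_even (by rwa [h2v]),
      by rw [h2l, hl1]⟩
  · -- `x ≡ e₁ ≡ e₂ ≡ e₃ (mod p)`: pass to `tᵢ = (x - eᵢ)/p`
    right
    rw [not_lt] at hv1
    set t₁ := (x - e₁) / p with ht₁
    set t₂ := (x - e₂) / p with ht₂
    set t₃ := (x - e₃) / p with ht₃
    set ε₁₂ := (e₁ - e₂) / p with hε₁₂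
    set ε₁₃ := (e₁ - e₃) / p with hε₁₃
    have hd₁t : x - e₁ = p * t₁ := by rw [ht₁, mul_div_cancel₀ _ hp0]
    have hd₂t : x - e₂ = p * t₂ := by rw [ht₂, mul_div_cancel₀ _ hp0]
    have hd₃t : x - e₃ = p * t₃ := by rw [ht₃, mul_div_cancel₀ _ hp0]
    have ht₁0 : t₁ ≠ 0 := div_ne_zero hd₁ hp0
    have ht₂0 : t₂ ≠ 0 := div_ne_zero hd₂ hp0
    have ht₃0 : t₃ ≠ 0 := div_ne_zero hd₃ hp0
    have hε₁₂0 : ε₁₂ ≠ 0 := div_ne_zero he12 hp0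
    have hε₁₃0 : ε₁₃ ≠ 0 := div_ne_zero he13 hp0
    have ht₂e : t₂ = ε₁₂ + t₁ := by rw [ht₂, hε₁₂, ht₁]; field_simp; ring
    have ht₃e : t₃ = ε₁₃ + t₁ := by rw [ht₃, hε₁₃, ht₁]; field_simp; ring
    -- valuations
    have hvt₁ : padicValRat p t₁ = v - 1 := by rw [ht₁, padicValRat.div hd₁ hp0, hvp]
    have hvt₂ : padicValRat p (x - e₂) = padicValRat p t₂ + 1 := by
      rw [ht₂, padicValRat.div hd₂ hp0, hvp]; ring
    have hvt₃ : padicValRat p (x - e₃) = padicValRat p t₃ + 1 := by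
      rw [ht₃, padicValRat.div hd₃ hp0, hvp]; ring
    have hvε₁₂ : padicValRat p ε₁₂ = 0 := by rw [hε₁₂, padicValRat.div he12 hp0, h12, hvp]; ring
    have hvε₁₃ : padicValRat p ε₁₃ = 0 := by rw [hε₁₃, padicValRat.div he13 hp0, h13, hvp]; ring
    have hε₂₃ : ε₁₃ - ε₁₂ = (e₂ - e₃) / p := by rw [hε₁₃, hε₁₂]; field_simp; ring
    have hvε₂₃ : padicValRat p (ε₁₃ - ε₁₂) = 0 := by
      rw [hε₂₃, padicValRat.div he23 hp0, h23, hvp]; ring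
    have hε₂₃0 : ε₁₃ - ε₁₂ ≠ 0 := by rw [hε₂₃]; exact div_ne_zero he23 hp0
    -- residue bits of the `tᵢ` are those of the `x - eᵢ`
    have hl₁ : qrBit p (x - e₁) = qrBit p t₁ := by rw [hd₁t, qrBit_natCast_mul]
    have hl₂ : qrBit p (x - e₂) = qrBit p t₂ := by rw [hd₂t, qrBit_natCast_mul]
    have hl₃ : qrBit p (x - e₃) = qrBit p t₃ := by rw [hd₃t, qrBit_natCast_mul]
    -- residue bits of the constants
    have hlε₁₂ : qrBit p ε₁₂ = qrBit p (e₁ - e₂) := by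
      rw [hε₁₂, div_eq_mul_inv, mul_comm, ← zpow_neg_one, qrBit_zpow_mul]
    have hlε₁₃ : qrBit p ε₁₃ = qrBit p (e₁ - e₃) := by
      rw [hε₁₃, div_eq_mul_inv, mul_comm, ← zpow_neg_one, qrBit_zpow_mul]
    have hlε₂₁ : qrBit p (-ε₁₂) = qrBit p (e₂ - e₁) := by
      rw [hε₁₂, ← neg_div, neg_sub, div_eq_mul_inv, mul_comm, ← zpow_neg_one, qrBit_zpow_mul]
    have hlε₃₁ : qrBit p (-ε₁₃) = qrBit p (e₃ - e₁) := by
      rw [hε₁₃, ← neg_div, neg_sub, div_eq_mul_inv, mul_comm, ← zpow_neg_one, qrBit_zpow_mul]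
    have hlε₂₃ : qrBit p (ε₁₃ - ε₁₂) = qrBit p (e₂ - e₃) := by
      rw [hε₂₃, div_eq_mul_inv, mul_comm, ← zpow_neg_one, qrBit_zpow_mul]
    have hlε₃₂ : qrBit p (-(ε₁₃ - ε₁₂)) = qrBit p (e₃ - e₂) := by
      rw [hε₂₃, ← neg_div, neg_sub, div_eq_mul_inv, mul_comm, ← zpow_neg_one, qrBit_zpow_mul]
    rw [hl₁, hl₂, hl₃] at hl
    rw [hvt₂, hvt₃] at hsum
    have hvt₁' : padicValRat p (x - e₁) = padicValRat p t₁ + 1 := by omega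
    by_cases hA : 1 ≤ padicValRat p t₁
    · -- `T₁`
      left
      have hv₂ : padicValRat p t₂ = 0 := by
        rw [ht₂e, ← hvε₁₂]
        exact (padicValRat_add_eq_left hε₁₂0 (Or.inr (by rw [hvε₁₂]; omega))).2
      have hv₃ : padicValRat p t₃ = 0 := by
        rw [ht₃e, ← hvε₁₃]
        exact (padicValRat_add_eq_left hε₁₃0 (Or.inr (by rw [hvε₁₃]; omega))).2
      have hlt₂ : qrBit p t₂ = qrBit p (e₁ - e₂) := by
        rw [ht₂e, ← hlε₁₂]; exact qrBit_add_eq_left hε₁₂0 (Or.inr (by rw [hvε₁₂]; omega))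
      have hlt₃ : qrBit p t₃ = qrBit p (e₁ - e₃) := by
        rw [ht₃e, ← hlε₁₃]; exact qrBit_add_eq_left hε₁₃0 (Or.inr (by rw [hvε₁₃]; omega))
      have hodd : Odd (padicValRat p t₁) := by
        obtain ⟨k, hk⟩ := hsum; exact ⟨k - 2, by omega⟩
      refine ⟨parityBit_eq_zero_of_even ?_, ?_, parityBit_eq_one_of_odd ?_, by rw [hl₂, hlt₂]⟩
      · rw [hvt₁']; exact hodd.add_one
      · rw [hl₁, zmod2_eq_add_of_add_add_eq_zero hl, hlt₂, hlt₃, qrBit_mul p he12 he13]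
      · rw [hvt₂, hv₂]; exact odd_one
    · right
      rw [not_le] at hA
      have hv₁ : padicValRat p t₁ = 0 := by omega
      by_cases hB : 1 ≤ padicValRat p t₂
      · -- `T₂`
        left
        have ht₁e : t₁ = -ε₁₂ + t₂ := by rw [ht₂e]; ring
        have ht₃e' : t₃ = (ε₁₃ - ε₁₂) + t₂ := by rw [ht₃e, ht₂e]; ring
        have hv₃ : padicValRat p t₃ = 0 := by
          rw [ht₃e', ← hvε₂₃]
          exact (padicValRat_add_eq_left hε₂₃0 (Or.inr (by rw [hvε₂₃]; omega))).2
        have hlt₁ : qrBit p t₁ = qrBit p (e₂ - e₁) := by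
          rw [ht₁e, ← hlε₂₁]
          exact qrBit_add_eq_left (neg_ne_zero.mpr hε₁₂0)
            (Or.inr (by rw [padicValRat.neg, hvε₁₂]; omega))
        have hlt₃ : qrBit p t₃ = qrBit p (e₂ - e₃) := by
          rw [ht₃e', ← hlε₂₃]; exact qrBit_add_eq_left hε₂₃0 (Or.inr (by rw [hvε₂₃]; omega))
        have hodd : Odd (padicValRat p t₂) := by
          obtain ⟨k, hk⟩ := hsum; exact ⟨k - 2, by omega⟩
        refine ⟨parityBit_eq_one_of_odd ?_, by rw [hl₁, hlt₁], parityBit_eq_zero_of_even ?_, ?_⟩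
        · rw [hvt₁', hv₁]; exact odd_one
        · rw [hvt₂]; exact hodd.add_one
        · have hl' : qrBit p t₂ = qrBit p t₁ + qrBit p t₃ := by
            have := zmod2_eq_add_of_add_add_eq_zero (a := qrBit p t₂) (b := qrBit p t₁)
              (c := qrBit p t₃) (by rw [← hl]; ring)
            exact this
          rw [hl₂, hl', hlt₁, hlt₃, qrBit_mul p (sub_ne_zero.mpr (Ne.symm (sub_ne_zero.mp he12)))
            he23]
      · -- `T₃`
        right
        rw [not_le] at hB
        have hv₂' : (1 : ℤ) ≤ padicValRat p (x - e₂) := by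
          have h2ge : (x - e₂) = 0 ∨ 1 ≤ padicValRat p (x - e₂) := by
            rw [hx₂]
            exact le_padicValRat_add_or (Or.inr hv1) (Or.inr (by rw [h12]))
          exact h2ge.resolve_left hd₂
        have hv₂ : padicValRat p t₂ = 0 := by omega
        have hodd : Odd (padicValRat p t₃) := by
          obtain ⟨k, hk⟩ := hsum; exact ⟨k - 2, by omega⟩
        have hv₃ : 1 ≤ padicValRat p t₃ := by
          have h3ge : (x - e₃) = 0 ∨ 1 ≤ padicValRat p (x - e₃) := by
            rw [hx₃]
            exact le_padicValRat_add_or (Or.inr hv1) (Or.inr (by rw [h13]))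
          have h0 : 0 ≤ padicValRat p t₃ := by have := h3ge.resolve_left hd₃; omega
          rcases h0.eq_or_lt with h0 | h0
          · exfalso; rw [← h0] at hodd; exact (Int.not_odd_iff_even.mpr ⟨0, rfl⟩) hodd
          · omega
        have ht₁e : t₁ = -ε₁₃ + t₃ := by rw [ht₃e]; ring
        have ht₂e' : t₂ = -(ε₁₃ - ε₁₂) + t₃ := by rw [ht₂e, ht₃e]; ring
        have hlt₁ : qrBit p t₁ = qrBit p (e₃ - e₁) := by
          rw [ht₁e, ← hlε₃₁]
          exact qrBit_add_eq_left (neg_ne_zero.mpr hε₁₃0)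
            (Or.inr (by rw [padicValRat.neg, hvε₁₃]; omega))
        have hlt₂ : qrBit p t₂ = qrBit p (e₃ - e₂) := by
          rw [ht₂e', ← hlε₃₂]
          exact qrBit_add_eq_left (neg_ne_zero.mpr hε₂₃0)
            (Or.inr (by rw [padicValRat.neg, hvε₂₃]; omega))
        refine ⟨parityBit_eq_one_of_odd ?_, by rw [hl₁, hlt₁], parityBit_eq_one_of_odd ?_,
          by rw [hl₂, hlt₂]⟩
        · rw [hvt₁', hv₁]; exact odd_one
        · rw [hvt₂, hv₂]; exact odd_one

end Curve

/-! ### The residue bit in terms of sign and valuation parities (square-free kernel) -/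

section Bridge

variable {p : ℕ} [hp : Fact p.Prime]

/-- `qrBit` of a product of non-zero naturals. [folklore] -/
theorem qrBit_prod_natCast (S : Finset ℕ) (hS : ∀ q ∈ S, q ≠ 0) :
    qrBit p (∏ q ∈ S, (q : ℚ)) = ∑ q ∈ S, qrBit p (q : ℚ) := by
  classical
  induction S using Finset.induction_on with
  | empty => simp [qrBit_one]
  | insert a S ha ih =>
    have hS' : ∀ q ∈ S, q ≠ 0 := fun q hq => hS q (Finset.mem_insert_of_mem hq)
    have ha0 : (a : ℚ) ≠ 0 := Nat.cast_ne_zero.mpr (hS a (Finset.mem_insert_self a S))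
    have hprod : (∏ q ∈ S, (q : ℚ)) ≠ 0 :=
      Finset.prod_ne_zero_iff.mpr fun q hq => Nat.cast_ne_zero.mpr (hS' q hq)
    rw [Finset.prod_insert ha, Finset.sum_insert ha, qrBit_mul p ha0 hprod, ih hS']

/-- Positive case of the square-free kernel formula. [folklore] -/
theorem qrBit_eq_sum_of_pos {w : ℚ} (hw : 0 < w) (T : Finset ℕ)
    (hT : ∀ q ∈ T, q.Prime) (heven : ∀ q : ℕ, q.Prime → q ∉ T → Even (padicValRat q w)) :
    qrBit p w = ∑ q ∈ T, parityBit q w * qrBit p (q : ℚ) := by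
  classical
  set S := T.filter fun q => ¬ Even (padicValRat q w) with hSdef
  have hS : ∀ q ∈ S, q.Prime := fun q hq => hT q (Finset.mem_filter.mp hq).1
  have hkey : ∀ q : ℕ, q.Prime → (Even (padicValRat q w) ↔ q ∉ S) := by
    intro q hq
    rw [hSdef, Finset.mem_filter, not_and, not_not]
    constructor
    · exact fun he _ => he
    · intro himp
      by_cases hqT : q ∈ T
      · exact himp hqT
      · exact heven q hq hqT
  obtain ⟨t, ht⟩ := exists_eq_prod_mul_sq hS hw hkey
  have hprod : (∏ q ∈ S, (q : ℚ)) ≠ 0 :=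
    Finset.prod_ne_zero_iff.mpr fun q hq => Nat.cast_ne_zero.mpr (hS q hq).ne_zero
  have ht0 : t ≠ 0 := by
    rintro rfl
    rw [zero_pow two_ne_zero, mul_zero] at ht
    exact hw.ne' ht
  rw [ht, qrBit_mul p hprod (pow_ne_zero 2 ht0), qrBit_sq, add_zero,
    qrBit_prod_natCast S fun q hq => (hS q hq).ne_zero, ← ht]
  -- compare the two sums over `T ⊇ S`
  have hSsub : S ⊆ T := Finset.filter_subset _ _
  rw [← Finset.sum_subset hSsub (f := fun q => parityBit q w * qrBit p (q : ℚ)) ?_]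
  · refine Finset.sum_congr rfl fun q hq => ?_
    have hodd : ¬ Even (padicValRat q w) := (Finset.mem_filter.mp hq).2
    rw [parityBit_eq_one_of_odd (Int.not_even_iff_odd.mp hodd), one_mul]
  · intro q hqT hqS
    have heven' : Even (padicValRat q w) := (hkey q (hT q hqT)).mpr hqS
    rw [parityBit_eq_zero_of_even heven', zero_mul]

/-- **The residue bit from the square-free kernel.** If the non-zero rational `r` has even
valuation at every prime outside the finite set of primes `T ∌ p` (except possibly at `p`), then
`qrBit p r = signBit r · qrBit p (-1) + Σ_{q ∈ T} (v_q(r) mod 2) · qrBit p q`: writing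
`u_p(r) = ± (∏_{q ∈ S} q) t²` (`S ⊆ T` the primes of odd valuation) and using multiplicativity.
This turns the local condition at `p` into a linear condition on the sign and parity
coordinates of the `2`-descent (how Legendre-symbol conditions enter `2`-Selmer computations).
[folklore] -/
theorem qrBit_eq_signBit_add_sum {r : ℚ} (hr : r ≠ 0) (T : Finset ℕ) (hT : ∀ q ∈ T, q.Prime)
    (hpT : p ∉ T) (heven : ∀ q : ℕ, q.Prime → q ∉ T → q ≠ p → Even (padicValRat q r)) :
    qrBit p r = signBit r * qrBit p (-1) + ∑ q ∈ T, parityBit q r * qrBit p (q : ℚ) := by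
  -- pass to the unit part `u`
  set u := unitPart p r with hu
  have hu0 : u ≠ 0 := unitPart_ne_zero p hr
  have hur : qrBit p r = qrBit p u := (qrBit_unitPart r).symm
  have hsr : signBit r = signBit u := (signBit_unitPart r).symm
  have hpar : ∀ q ∈ T, parityBit q r = parityBit q u := by
    intro q hq
    haveI : Fact q.Prime := ⟨hT q hq⟩
    have hqp : q ≠ p := fun h => hpT (h ▸ hq)
    rw [parityBit, parityBit, hu, padicValRat_unitPart_of_ne hqp]
  have hevenu : ∀ q : ℕ, q.Prime → q ∉ T → Even (padicValRat q u) := by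
    intro q hq hqT
    haveI : Fact q.Prime := ⟨hq⟩
    by_cases hqp : q = p
    · rw [hqp, hu, padicValRat_unitPart p hr]; exact ⟨0, rfl⟩
    · rw [hu, padicValRat_unitPart_of_ne hqp]; exact heven q hq hqT hqp
  rw [hur, hsr, Finset.sum_congr rfl fun q hq => by rw [hpar q hq]]
  -- sign
  rcases lt_or_gt_of_ne hu0 with hneg | hpos
  · have hw : 0 < -u := neg_pos.mpr hneg
    have key := qrBit_eq_sum_of_pos (p := p) hw T hT fun q hq hqT => by
      rw [padicValRat.neg]; exact hevenu q hq hqT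
    rw [show u = -(-u) by ring, qrBit_neg hw.ne', key, signBit, if_pos (by linarith), one_mul]
    congr 1
    refine Finset.sum_congr rfl fun q _ => ?_
    rw [parityBit, parityBit, neg_neg, padicValRat.neg]
  · have key := qrBit_eq_sum_of_pos (p := p) hpos T hT hevenu
    rw [key, signBit, if_neg (not_lt.mpr hpos.le), zero_mul, zero_add]

/-- List form of `qrBit_eq_signBit_add_sum` (the sum over an explicit list of primes unfolds by
`simp`). [folklore] -/
theorem qrBit_eq_signBit_add_listSum {r : ℚ} (hr : r ≠ 0) (l : List ℕ) (hl : l.Nodup)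
    (hprime : ∀ q ∈ l, q.Prime) (hpl : p ∉ l)
    (heven : ∀ q : ℕ, q.Prime → q ∉ l → q ≠ p → Even (padicValRat q r)) :
    qrBit p r = signBit r * qrBit p (-1) + (l.map fun q => parityBit q r * qrBit p (q : ℚ)).sum := by
  have key := qrBit_eq_signBit_add_sum hr l.toFinset (fun q hq => hprime q (List.mem_toFinset.mp hq))
    (fun h => hpl (List.mem_toFinset.mp h))
    (fun q hq hql hqp => heven q hq (fun h => hql (List.mem_toFinset.mpr h)) hqp)
  rw [key, List.sum_toFinset _ hl]

end Bridge


end Literature.NumberTheory.EllipticCurves.TwoDescentLocal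

end
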